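import Literature.Analysis.Calculus.ClosedSubgroupExpChart
import Literature.Analysis.Matrix.DetExp
import Literature.AnabelianGeometry.AbsoluteAnabelian.AutHolomorphicSpacesPSL2RLemmas
import Mathlib.Topology.Algebra.Group.Quotient
import Mathlib.Topology.Algebra.Group.Matrix
import Mathlib.LinearAlgebra.Matrix.SpecialLinearGroup
import Mathlib.Topology.Algebra.OpenSubgroup
import Mathlib.Topology.Algebra.Group.ClosedSubgroup

/-!
# One-parameter subgroups of `PSL₂(ℝ)`, I: the Lie algebra of a closed subgroup
# ([AbsTopIII] Cor. 2.7 (d), PROOF-ONLY infrastructure)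

Towards the discharge of the named fact `OneParameterSubgroupsPSL2R` of
`ArchimedeanReconstruction.lean` ([MochizukiAbsTopIII2015] Corollary 2.7 (d) p.59: the
one-parameter subgroups of `Aut(𝕍) ≅ SL₂(ℝ)/{±1}` characterised topologically), this file sets up
`G = SL₂(ℝ)/{±1}` (`Matrix.SpecialLinearGroup (Fin 2) ℝ ⧸ center`, quotient topology) and, for a
CLOSED subgroup `S ≤ G`, the Lie algebra `𝔥 = {X ∈ M₂(ℝ) | exp(tX) ∈ π⁻¹(S) ∀ t}` of its preimage
`π⁻¹(S) ⊆ SL₂(ℝ) ⊆ M₂(ℝ)` — a real vector subspace of `𝔰𝔩₂(ℝ)` by von Neumann's theorem (tree: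
`Literature.Analysis.Calculus.exp_smul_add_mem`) — together with the EXPONENTIAL CHART (tree:
`Literature.Analysis.Calculus.exists_exp_chart_of_isClosed`): every element of `S` close to `1` is
`π(exp X)` with `X ∈ 𝔥` small (`exists_lieAlgebra`). Also (the centre of `SL₂(ℝ)` being `{±1}`,
tree `mem_center_sl_iff` of `AutHolomorphicSpacesPSL2RLemmas.lean`): the
one-parameter groups `t ↦ exp(tX) ∈ SL₂(ℝ)` for traceless `X` (`exists_expHom`, via
`det (exp X) = exp (tr X)` of `Literature.Analysis.Matrix.det_exp_eq_exp_trace`), and "a connected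
topological group is generated by any neighbourhood of the identity" in the form used below
(`Subgroup.eq_of_isConnected_of_nhds_one`).

Everything is a theorem (no definitions, no named facts): objects needed downstream are delivered
by existence statements. No side is taken on anything in [IUTchIII]; this is classical Lie theory
(Hall 2015 §2–§3 [Hall2015]; von Neumann 1929 [vonNeumann1929]) serving a cited reconstruction
step of [AbsTopIII] §2.
-/

noncomputable section

open NormedSpace Filter Topology Set

namespace Literature.AnabelianGeometry.AbsoluteAnabelian

namespace OneParameterSubgroupsPSL2R

open Matrix

open scoped MatrixGroups

/-! ### A connected group is generated by any neighbourhood of `1` -/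

/-- **A connected topological group is generated by any neighbourhood of the identity**, in the
form: if `L ≤ S` are subgroups of a topological group, `S` is connected and `L` contains all
elements of `S` sufficiently close to `1`, then `L = S` (an open subgroup is closed, hence clopen in
the connected space `S`). Used for the one-parameter subgroups of `Aut(𝕍) ≅ SL₂(ℝ)/{±1}`.
[cite: MochizukiAbsTopIII2015, Corollary 2.7 (d) p.59] -/
theorem _root_.Subgroup.eq_of_isConnected_of_nhds_one {G : Type*} [Group G] [TopologicalSpace G]
    [IsTopologicalGroup G] (S L : Subgroup G) (hLS : L ≤ S) (hS : IsConnected (S : Set G))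
    (hV : ∃ V ∈ 𝓝 (1 : G), ∀ s ∈ S, s ∈ V → s ∈ L) : L = S := by
  obtain ⟨V, hV1, hVL⟩ := hV
  haveI : ConnectedSpace S := isConnected_iff_connectedSpace.mp hS
  let L' : Subgroup S := L.subgroupOf S
  have hmem : ((L' : Set S)) ∈ 𝓝 (1 : S) := by
    have h1 : ((↑) : S → G) ⁻¹' V ∈ 𝓝 (1 : S) :=
      continuous_subtype_val.continuousAt.preimage_mem_nhds (by simpa using hV1)
    exact Filter.mem_of_superset h1 fun s hs => hVL s s.2 hs
  have hopen : IsOpen (L' : Set S) := Subgroup.isOpen_of_mem_nhds L' hmem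
  have hclosed : IsClosed (L' : Set S) := Subgroup.isClosed_of_isOpen L' hopen
  have huniv : (L' : Set S) = Set.univ :=
    IsClopen.eq_univ ⟨hclosed, hopen⟩ ⟨1, L'.one_mem⟩
  refine le_antisymm hLS fun s hs => ?_
  have : (⟨s, hs⟩ : S) ∈ (L' : Set S) := by rw [huniv]; exact Set.mem_univ _
  exact this

/-! ### The centre `{±1}` of `SL₂(ℝ)` and the quotient `G = SL₂(ℝ)/{±1}` -/

/-- The centre `{±1}` of `SL₂(ℝ)` is closed (a finite set in a `T₁` group), so `SL₂(ℝ)/{±1}` is a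
Hausdorff locally compact topological group. [cite: MochizukiAbsTopIII2015, Corollary 2.7 (d) p.59] -/
theorem isClosed_center : IsClosed ((Subgroup.center SL(2, ℝ) : Subgroup SL(2, ℝ)) : Set SL(2, ℝ)) := by
  have : ((Subgroup.center SL(2, ℝ) : Subgroup SL(2, ℝ)) : Set SL(2, ℝ)) = {1, -1} := by
    ext g; simp [mem_center_sl_iff]
  rw [this]
  exact (Set.toFinite _).isClosed

/-- `π(g) = 1` in `SL₂(ℝ)/{±1}` iff `g = ±1`. [cite: MochizukiAbsTopIII2015, Corollary 2.7 (d) p.59] -/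
theorem mk_eq_one_iff (g : SL(2, ℝ)) : (g : SL(2, ℝ) ⧸ Subgroup.center SL(2, ℝ)) = 1 ↔ g = 1 ∨ g = -1 := by
  rw [QuotientGroup.eq_one_iff, mem_center_sl_iff]

/-- `π(g) = π(h)` in `SL₂(ℝ)/{±1}` iff `h = ±g`. [cite: MochizukiAbsTopIII2015, Corollary 2.7 (d) p.59] -/
theorem mk_eq_mk_iff (g h : SL(2, ℝ)) : (g : SL(2, ℝ) ⧸ Subgroup.center SL(2, ℝ)) = (h : SL(2, ℝ) ⧸ Subgroup.center SL(2, ℝ)) ↔ h = g ∨ h = -g := by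
  rw [QuotientGroup.eq, mem_center_sl_iff]
  constructor
  · rintro (h1 | h1)
    · left; simpa using (eq_mul_of_inv_mul_eq h1)
    · right
      have := eq_mul_of_inv_mul_eq h1
      simpa using this
  · rintro (rfl | rfl)
    · simp
    · right; simp

/-- `SL₂(ℝ)` is locally compact (a closed subset of `M₂(ℝ) ≅ ℝ⁴`).
[cite: MochizukiAbsTopIII2015, Corollary 2.7 (d) p.59] -/
theorem locallyCompactSpace_SL2 : LocallyCompactSpace SL(2, ℝ) :=
  haveI : LocallyCompactSpace (Matrix (Fin 2) (Fin 2) ℝ) := inferInstanceAs (LocallyCompactSpace (Fin 2 → Fin 2 → ℝ))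
  (Matrix.SpecialLinearGroup.isClosedEmbedding_val (n := Fin 2) (R := ℝ)).locallyCompactSpace

/-! ### One-parameter groups `t ↦ exp (tX)` in `SL₂(ℝ)` -/

open scoped Matrix.Norms.Operator

-- As in `Mathlib/Analysis/Normed/Algebra/MatrixExponential.lean` and the tree's `DetExp.lean`: the
-- scoped `L∞`-operator normed ring structure on matrices is only reducibly-defeq to the Pi
-- uniformity, so `CompleteSpace` and the analytic facts about `exp` need this setting.
set_option backward.isDefEq.respectTransparency false

/-- `det (exp (tX)) = 1` for traceless `X` (`det e^Y = e^{tr Y}`, tree `det_exp_eq_exp_trace`): the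
one-parameter group of a traceless matrix lies in `SL₂(ℝ)`.
[cite: Hall2015, Thm. 2.12 p.36; MochizukiAbsTopIII2015, Corollary 2.7 (d) p.59] -/
theorem det_exp_smul_eq_one (X : Matrix (Fin 2) (Fin 2) ℝ) (hX : X.trace = 0) (t : ℝ) : (exp (t • X)).det = 1 := by
  rw [Literature.Analysis.Matrix.det_exp_eq_exp_trace, Matrix.trace_smul, hX, smul_zero,
    NormedSpace.exp_zero]

/-- Conversely, if `det (exp (tX)) = 1` for all `t` then `X` is traceless (`e^{t tr X} = 1` for all
`t`). [cite: Hall2015, Thm. 2.12 p.36; MochizukiAbsTopIII2015, Corollary 2.7 (d) p.59] -/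
theorem trace_eq_zero_of_det_exp_smul_eq_one (X : Matrix (Fin 2) (Fin 2) ℝ) (h : ∀ t : ℝ, (exp (t • X)).det = 1) :
    X.trace = 0 := by
  have h1 := h 1
  rw [one_smul, Literature.Analysis.Matrix.det_exp_eq_exp_trace, ← Real.exp_eq_exp_ℝ,
    Real.exp_eq_one_iff] at h1
  exact h1

/-- **The one-parameter group of a traceless `X ∈ M₂(ℝ)` as a continuous homomorphism
`ℝ → SL₂(ℝ)`**, `t ↦ exp (tX)` (Hall 2015 Def. 2.13 / Prop. 2.3: `e^{(s+t)X} = e^{sX} e^{tX}`).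
[cite: Hall2015, Def. 2.13 p.41; MochizukiAbsTopIII2015, Corollary 2.7 (d) p.59] -/
theorem exists_expHom (X : Matrix (Fin 2) (Fin 2) ℝ) (hX : X.trace = 0) :
    ∃ φ : Multiplicative ℝ →* SL(2, ℝ), Continuous φ ∧
      ∀ t : ℝ, ((φ (Multiplicative.ofAdd t) : SL(2, ℝ)) : Matrix (Fin 2) (Fin 2) ℝ) = exp (t • X) := by
  let φ : Multiplicative ℝ →* SL(2, ℝ) :=
    { toFun := fun t => ⟨exp (t.toAdd • X), det_exp_smul_eq_one X hX _⟩
      map_one' := by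
        apply Subtype.ext
        simp [NormedSpace.exp_zero]
      map_mul' := fun s t => by
        apply Subtype.ext
        simp only [toAdd_mul, add_smul, Matrix.SpecialLinearGroup.coe_mul]
        exact exp_add_of_commute (((Commute.refl X).smul_left _).smul_right _) }
  refine ⟨φ, ?_, fun t => rfl⟩
  refine continuous_induced_rng.2 ?_
  change Continuous fun t : Multiplicative ℝ => exp (t.toAdd • X)
  exact NormedSpace.exp_continuous.comp (continuous_toAdd.smul continuous_const)

/-! ### The Lie algebra and exponential chart of a closed subgroup of `SL₂(ℝ)/{±1}` -/

/-- **The Lie algebra of a closed subgroup `S ≤ SL₂(ℝ)/{±1}` and its exponential chart** (von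
Neumann 1929 / Cartan, tree `exists_exp_chart_of_isClosed`, applied to `π⁻¹(S) ⊆ M₂(ℝ)`): there is
a real subspace `𝔥 ⊆ 𝔰𝔩₂(ℝ)` with `X ∈ 𝔥 ⟺ π(exp tX) ∈ S` for all `t`, such that for every `ρ > 0`
all elements of `S` in some neighbourhood of `1` are of the form `π(exp X)`, `X ∈ 𝔥`, `‖X‖ < ρ`
(`L∞`-operator norm). [cite: vonNeumann1929, §3, Satz; MochizukiAbsTopIII2015, Corollary 2.7 (d) p.59] -/
theorem exists_lieAlgebra (S : Subgroup (SL(2, ℝ) ⧸ Subgroup.center SL(2, ℝ))) (hS : IsClosed (S : Set (SL(2, ℝ) ⧸ Subgroup.center SL(2, ℝ)))) :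
    ∃ 𝔥 : Submodule ℝ (Matrix (Fin 2) (Fin 2) ℝ),
      (∀ X : (Matrix (Fin 2) (Fin 2) ℝ), X ∈ 𝔥 ↔ ∀ t : ℝ, ∃ g : SL(2, ℝ), (g : Matrix (Fin 2) (Fin 2) ℝ) = exp (t • X) ∧ (g : SL(2, ℝ) ⧸ Subgroup.center SL(2, ℝ)) ∈ S) ∧
      (∀ X ∈ 𝔥, X.trace = 0) ∧
      ∀ ρ : ℝ, 0 < ρ → ∃ V ∈ 𝓝 (1 : SL(2, ℝ) ⧸ Subgroup.center SL(2, ℝ)), ∀ g : SL(2, ℝ), (g : SL(2, ℝ) ⧸ Subgroup.center SL(2, ℝ)) ∈ V → (g : SL(2, ℝ) ⧸ Subgroup.center SL(2, ℝ)) ∈ S →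
        ∃ X ∈ 𝔥, ∃ g' : SL(2, ℝ), ‖X‖ < ρ ∧ (g' : Matrix (Fin 2) (Fin 2) ℝ) = exp X ∧ (g' : SL(2, ℝ) ⧸ Subgroup.center SL(2, ℝ)) = (g : SL(2, ℝ) ⧸ Subgroup.center SL(2, ℝ)) := by
  -- the preimage `H = π⁻¹(S) ⊆ M₂(ℝ)`
  let H : Set (Matrix (Fin 2) (Fin 2) ℝ) := {M | ∃ g : SL(2, ℝ), (g : Matrix (Fin 2) (Fin 2) ℝ) = M ∧ (g : SL(2, ℝ) ⧸ Subgroup.center SL(2, ℝ)) ∈ S}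
  have hHdef : ∀ M, M ∈ H ↔ ∃ g : SL(2, ℝ), (g : Matrix (Fin 2) (Fin 2) ℝ) = M ∧ (g : SL(2, ℝ) ⧸ Subgroup.center SL(2, ℝ)) ∈ S := fun M => Iff.rfl
  have hH : IsClosed H := by
    have h1 : IsClosed (((↑) : SL(2, ℝ) → (SL(2, ℝ) ⧸ Subgroup.center SL(2, ℝ))) ⁻¹' (S : Set (SL(2, ℝ) ⧸ Subgroup.center SL(2, ℝ)))) :=
      hS.preimage QuotientGroup.continuous_mk
    have h2 := (Matrix.SpecialLinearGroup.isClosedEmbedding_val (n := Fin 2) (R := ℝ)).isClosedMap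
      _ h1
    convert h2 using 1
    ext M
    simp only [hHdef, Set.mem_image, Set.mem_preimage, SetLike.mem_coe]
    constructor
    · rintro ⟨g, hgM, hgS⟩; exact ⟨g, hgS, hgM⟩
    · rintro ⟨g, hgS, hgM⟩; exact ⟨g, hgM, hgS⟩
  have h1 : (1 : Matrix (Fin 2) (Fin 2) ℝ) ∈ H := ⟨1, by simp, by simp [S.one_mem]⟩
  have hmul : ∀ a ∈ H, ∀ b ∈ H, a * b ∈ H := by
    rintro a ⟨g, rfl, hg⟩ b ⟨h, rfl, hh⟩
    exact ⟨g * h, by simp, by simpa using S.mul_mem hg hh⟩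
  have hinv : ∀ a ∈ H, ∃ b ∈ H, b * a = 1 := by
    rintro a ⟨g, rfl, hg⟩
    refine ⟨(g⁻¹ : SL(2, ℝ)), ⟨g⁻¹, rfl, by simpa using S.inv_mem hg⟩, ?_⟩
    rw [← Matrix.SpecialLinearGroup.coe_mul, inv_mul_cancel]
    rfl
  -- the Lie algebra
  let 𝔥 : Submodule ℝ (Matrix (Fin 2) (Fin 2) ℝ) :=
    { carrier := {X | ∀ t : ℝ, exp (t • X) ∈ H}
      add_mem' := fun {X Y} hX hY t =>
        Literature.Analysis.Calculus.exp_smul_add_mem hH h1 hmul hinv hX hY t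
      zero_mem' := fun t => by simpa using h1
      smul_mem' := fun c X hX t => by simpa [smul_smul] using hX (t * c) }
  have hmem : ∀ {X : (Matrix (Fin 2) (Fin 2) ℝ)}, X ∈ 𝔥 ↔ ∀ t : ℝ, exp (t • X) ∈ H := fun {X} => Iff.rfl
  refine ⟨𝔥, fun X => ?_, fun X hX => ?_, fun ρ hρ => ?_⟩
  · -- membership
    exact Iff.rfl
  · -- traceless
    refine trace_eq_zero_of_det_exp_smul_eq_one X fun t => ?_
    obtain ⟨g, hg, -⟩ := (hmem.mp hX) t
    rw [← hg]
    exact g.2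
  · -- the exponential chart
    obtain ⟨r, hr, hchart⟩ :=
      Literature.Analysis.Calculus.exists_exp_chart_of_isClosed hH h1 hmul hinv
    set δ : ℝ := min r (ρ / 2) with hδ
    have hδpos : 0 < δ := lt_min hr (by linarith)
    let U : Set SL(2, ℝ) := {g | ‖(g : Matrix (Fin 2) (Fin 2) ℝ) - 1‖ < δ}
    have hUopen : IsOpen U := by
      have : IsOpen {M : (Matrix (Fin 2) (Fin 2) ℝ) | ‖M - 1‖ < δ} := by
        have hc : Continuous fun M : (Matrix (Fin 2) (Fin 2) ℝ) => ‖M - 1‖ := by fun_prop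
        exact isOpen_lt hc continuous_const
      exact this.preimage Matrix.SpecialLinearGroup.isClosedEmbedding_val.continuous
    have h1U : (1 : SL(2, ℝ)) ∈ U := by
      change ‖((1 : SL(2, ℝ)) : Matrix (Fin 2) (Fin 2) ℝ) - 1‖ < δ
      simpa using hδpos
    refine ⟨((↑) : SL(2, ℝ) → (SL(2, ℝ) ⧸ Subgroup.center SL(2, ℝ))) '' U, ?_, fun g hgV hgS => ?_⟩
    · exact (QuotientGroup.isOpenMap_coe.image_mem_nhds (hUopen.mem_nhds h1U) :)
    obtain ⟨g₀, hg₀U, hg₀g⟩ := hgV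
    have hg₀S : (g₀ : SL(2, ℝ) ⧸ Subgroup.center SL(2, ℝ)) ∈ S := by rw [hg₀g]; exact hgS
    have hg₀H : (g₀ : Matrix (Fin 2) (Fin 2) ℝ) ∈ H := ⟨g₀, rfl, hg₀S⟩
    have hg₀r : ‖(g₀ : Matrix (Fin 2) (Fin 2) ℝ) - 1‖ < r := lt_of_lt_of_le hg₀U (min_le_left _ _)
    obtain ⟨X, hXH, hXg, hXn⟩ := hchart _ hg₀H hg₀r
    refine ⟨X, hmem.mpr hXH, g₀, ?_, hXg.symm, hg₀g⟩
    have : ‖(g₀ : Matrix (Fin 2) (Fin 2) ℝ) - 1‖ < ρ / 2 := lt_of_lt_of_le hg₀U (min_le_right _ _)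
    linarith

end OneParameterSubgroupsPSL2R

end Literature.AnabelianGeometry.AbsoluteAnabelian

end
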